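import Mathlib
import HarnessLib

/-!
# The Herglotz–Riesz representation theorem on the unit disc

First support file for the discharge of the named fact
`Literature.Analysis.Complex.nevanlinna_representation` (Rosenblum–Rovnyak 1985, Appendix §6,
Theorem B, stated there without proof, with references to Boas, de Branges, Duren, Hoffman and
Krylov). We prove the disc form of the representation theorem, from which the half-plane
(Nevanlinna) form follows by a Cayley transform (sibling file `PickFunctionsProofsCayley`):

* `circleAverage_herglotz_kernel_mul_re` — **Schwarz's integral formula**: for `G` holomorphic on
  the open unit disc and continuous on the closed disc,
  `(2π)⁻¹ ∫₀^{2π} (e^{iθ} + w)/(e^{iθ} - w) Re G(e^{iθ}) dθ = G(w) - i Im G(0)` (`|w| < 1`).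
  Proof: the left side is holomorphic in `w` (a Cauchy integral, Mathlib
  `hasFPowerSeriesOn_cauchy_integral`), its real part is the Poisson integral of `Re G`, which is
  `Re G(w)` by Mathlib's Poisson formula `DiffContOnCl.circleAverage_re_herglotzRieszKernel_smul`,
  so it differs from `G` by a constant (`AnalyticOnNhd.eq_const_of_re_eq_const`), computed at
  `w = 0` by the mean value property (`DiffContOnCl.circleAverage`);
* `circleAverage_herglotz_kernel_mul_re_scaled` and its real/imaginary parts — the same for
  `G(r·)`, `0 ≤ r < 1`, when `G` is only holomorphic on the open disc;
* `exists_strongDual_circleAverage` — a nonnegative continuous weight on the circle gives a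
  positive bounded functional on `C(𝕊, ℝ)` (`𝕊 = sphere 0 1`);
* `exists_measure_herglotz_riesz` — **Herglotz–Riesz theorem**: `G` holomorphic on the disc with
  `Re G ≥ 0` is `G(w) = i Im G(0) + ∫_𝕊 (ζ + w)/(ζ - w) dν(ζ)` for a finite positive Borel
  measure `ν` on `𝕊`. Proof: the functionals `φ ↦ (2π)⁻¹ ∫ φ(e^{iθ}) Re G(rₙ e^{iθ}) dθ`,
  `rₙ = 1 - 1/(n+2)`, have norm `≤ Re G(0)`; a weak-* cluster point (Banach–Alaoglu,
  `WeakDual.isCompact_closedBall`) is positive, hence a measure (Riesz–Markov–Kakutani,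
  `RealRMK.rieszMeasure`), and its values on the kernel functions are the limits
  `Re G(w)`, `Im G(w) - Im G(0)` of the scaled Schwarz formula.

No new definitions. Everything here is classical (Herglotz 1911, F. Riesz 1911; e.g. Duren,
*Theory of Hᵖ spaces* (1970), Ch. 1) and tagged folklore.
-/

noncomputable section

open MeasureTheory Metric Set Filter Real
open _root_.Complex
open scoped Topology ComplexConjugate CompactlySupported

namespace Literature.Analysis.Complex

/-! ### The Schwarz integral formula on the unit disc -/

/-- The kernel identity `(ζ + w)/(ζ - w) = 1 + 2w(ζ - w)⁻¹` (`ζ ≠ w`). [folklore] -/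
theorem herglotz_kernel_eq_one_add {ζ w : ℂ} (h : ζ ≠ w) :
    (ζ + w) / (ζ - w) = 1 + 2 * w * (ζ - w)⁻¹ := by
  have : ζ - w ≠ 0 := sub_ne_zero.2 h
  field_simp
  ring

/-- A point of the open unit disc is not on the unit circle. [folklore] -/
theorem ne_of_mem_sphere_of_mem_ball {ζ w : ℂ} (hζ : ζ ∈ sphere (0 : ℂ) 1) (hw : w ∈ ball (0 : ℂ) 1) :
    ζ ≠ w := by
  rintro rfl
  simp only [mem_sphere_iff_norm, sub_zero] at hζ
  simp only [mem_ball, dist_zero_right] at hw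
  linarith

/-- For `g` continuous on the unit circle, `w ↦ (2π)⁻¹ ∫₀^{2π} (e^{iθ} - w)⁻¹ g(e^{iθ}) dθ` is
holomorphic on the open unit disc: it is the Cauchy integral of `g(z)/z`. [folklore] -/
theorem differentiableOn_circleAverage_inv_sub_mul {g : ℂ → ℂ} (hg : ContinuousOn g (sphere 0 1)) :
    DifferentiableOn ℂ (fun w => circleAverage (fun ζ => (ζ - w)⁻¹ * g ζ) 0 1) (ball 0 1) := by
  have hci : CircleIntegrable (fun z => z⁻¹ * g z) 0 (1 : NNReal) := by
    apply ContinuousOn.circleIntegrable zero_le_one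
    refine ContinuousOn.mul (ContinuousOn.inv₀ continuousOn_id ?_) (by simpa using hg)
    intro z hz h0
    simp [h0] at hz
  have hps := hasFPowerSeriesOn_cauchy_integral hci one_pos
  have hd := hps.differentiableOn
  rw [NNReal.coe_one, ENNReal.coe_one, ← ENNReal.ofReal_one, Metric.eball_ofReal] at hd
  refine hd.congr fun w _ => ?_
  rw [Real.circleAverage_eq_circleIntegral one_ne_zero]
  simp only [sub_zero, smul_eq_mul]
  congr 2
  funext z
  ring

/-- **Schwarz's integral formula** on the unit disc: for `G` holomorphic on the open unit disc and
continuous on the closed disc, and `|w| < 1`,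
`(2π)⁻¹ ∫₀^{2π} (e^{iθ} + w)/(e^{iθ} - w) · Re G(e^{iθ}) dθ = G(w) - i Im G(0)`.
Proof: the left side is holomorphic in `w`, its real part is the Poisson integral of `Re G`, i.e.
`Re G(w)` (Mathlib's Poisson formula), so it differs from `G` by an imaginary constant (open
mapping theorem), evaluated at `w = 0` by the mean value property. [folklore] -/
theorem circleAverage_herglotz_kernel_mul_re {G : ℂ → ℂ} (hG : DiffContOnCl ℂ G (ball 0 1)) {w : ℂ}
    (hw : w ∈ ball (0 : ℂ) 1) :
    circleAverage (fun ζ => (ζ + w) / (ζ - w) * ((G ζ).re : ℂ)) 0 1 = G w - I * (G 0).im := by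
  -- continuity of `Re G` on the circle
  have hGc : ContinuousOn G (sphere (0 : ℂ) 1) := by
    have := hG.continuousOn
    rw [closure_ball (0 : ℂ) one_ne_zero] at this
    exact this.mono sphere_subset_closedBall
  have hgc : ContinuousOn (fun ζ => ((G ζ).re : ℂ)) (sphere (0 : ℂ) 1) :=
    (continuous_ofReal.comp continuous_re).comp_continuousOn hGc
  -- the left-hand side as a function of `w`
  set Φ : ℂ → ℂ := fun w => circleAverage (fun ζ => (ζ + w) / (ζ - w) * ((G ζ).re : ℂ)) 0 1 with hΦ
  -- `Φ w = A + 2 w Ψ w`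
  have hΦeq : ∀ w ∈ ball (0 : ℂ) 1, Φ w = circleAverage (fun ζ => ((G ζ).re : ℂ)) 0 1 +
      2 * w * circleAverage (fun ζ => (ζ - w)⁻¹ * ((G ζ).re : ℂ)) 0 1 := by
    intro w hw
    have hcont1 : ContinuousOn (fun ζ : ℂ => (ζ - w)⁻¹ * ((G ζ).re : ℂ)) (sphere (0:ℂ) 1) := by
      refine ContinuousOn.mul (ContinuousOn.inv₀ (continuousOn_id.sub continuousOn_const) ?_) hgc
      intro z hz
      exact sub_ne_zero.2 (ne_of_mem_sphere_of_mem_ball hz hw)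
    have h1 : circleAverage (fun ζ => (ζ + w) / (ζ - w) * ((G ζ).re : ℂ)) 0 1 =
        circleAverage (fun ζ => ((G ζ).re : ℂ) + (2 * w) • ((ζ - w)⁻¹ * ((G ζ).re : ℂ))) 0 1 := by
      apply circleAverage_congr_sphere
      intro ζ hζ
      rw [abs_one] at hζ
      simp only [smul_eq_mul]
      rw [herglotz_kernel_eq_one_add (ne_of_mem_sphere_of_mem_ball hζ hw)]
      ring
    rw [hΦ]
    dsimp only
    have hint2 : CircleIntegrable (fun ζ : ℂ => (2 * w) • ((ζ - w)⁻¹ * ((G ζ).re : ℂ))) 0 1 := by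
      apply ContinuousOn.circleIntegrable zero_le_one
      exact ContinuousOn.fun_smul continuousOn_const hcont1
    rw [h1, circleAverage_fun_add (hgc.circleIntegrable zero_le_one) hint2, circleAverage_fun_smul,
      smul_eq_mul]
  -- hence `Φ` is holomorphic on the disc
  have hΦd : DifferentiableOn ℂ Φ (ball 0 1) := by
    have h2 : DifferentiableOn ℂ (fun w => circleAverage (fun ζ => ((G ζ).re : ℂ)) 0 1 +
        2 * w * circleAverage (fun ζ => (ζ - w)⁻¹ * ((G ζ).re : ℂ)) 0 1) (ball 0 1) := by
      apply DifferentiableOn.add (differentiableOn_const _)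
      apply DifferentiableOn.mul (by fun_prop) (differentiableOn_circleAverage_inv_sub_mul hgc)
    exact h2.congr hΦeq
  -- real part of `Φ` is the Poisson integral of `Re G`, i.e. `Re G`
  have hre : ∀ w ∈ ball (0 : ℂ) 1, (Φ w - G w).re = 0 := by
    intro w hw
    have hP := hG.circleAverage_re_herglotzRieszKernel_smul hw
    have hcontk : ContinuousOn (fun ζ : ℂ => (ζ + w) / (ζ - w)) (sphere (0:ℂ) 1) := by
      refine ContinuousOn.div (by fun_prop) (by fun_prop) ?_
      intro z hz
      exact sub_ne_zero.2 (ne_of_mem_sphere_of_mem_ball hz hw)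
    have hi1 : CircleIntegrable (fun ζ => (ζ + w) / (ζ - w) * ((G ζ).re : ℂ)) 0 1 :=
      (hcontk.mul hgc).circleIntegrable zero_le_one
    have hi2 : CircleIntegrable ((re ∘ herglotzRieszKernel 0 w) • G) 0 1 := by
      apply ContinuousOn.circleIntegrable zero_le_one
      refine ContinuousOn.smul (continuous_re.comp_continuousOn ?_) hGc
      simpa [herglotzRieszKernel_fun_def] using hcontk
    have e1 : (Φ w).re = circleAverage (fun ζ => ((ζ + w) / (ζ - w)).re * (G ζ).re) 0 1 := by
      rw [hΦ]
      dsimp only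
      rw [← reCLM_apply, ← ContinuousLinearMap.circleAverage_comp_comm reCLM hi1]
      congr 1
      funext ζ
      simp [Complex.mul_re]
    have e2 : (G w).re = circleAverage (fun ζ => ((ζ + w) / (ζ - w)).re * (G ζ).re) 0 1 := by
      rw [← hP, ← reCLM_apply, ← ContinuousLinearMap.circleAverage_comp_comm reCLM hi2]
      congr 1
      funext ζ
      simp [herglotzRieszKernel_def]
    rw [sub_re, e1, e2, sub_self]
  -- so `Φ - G` is an (imaginary) constant
  have hconst := AnalyticOnNhd.eq_const_of_re_eq_const (f := fun w => Φ w - G w) (U := ball 0 1)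
    (c₀ := 0) ((hΦd.sub hG.differentiableOn).analyticOnNhd isOpen_ball) hre isOpen_ball
    ((convex_ball (0 : ℂ) 1).isConnected (by simp))
  obtain ⟨c, hc⟩ := hconst
  have h0 : (0 : ℂ) ∈ ball (0 : ℂ) 1 := by simp
  have hc0 := hc 0 h0
  have hcw := hc w hw
  -- value at `0`
  have hmv : circleAverage G 0 1 = G 0 := by
    have h := hG
    rw [← abs_one] at h
    exact h.circleAverage
  have hΦ0 : Φ 0 = ((G 0).re : ℂ) := by
    rw [hΦ]
    dsimp only
    have : circleAverage (fun ζ => (ζ + 0) / (ζ - 0) * ((G ζ).re : ℂ)) 0 1 =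
        circleAverage (fun ζ => ((G ζ).re : ℂ)) 0 1 := by
      apply circleAverage_congr_sphere
      intro ζ hζ
      rw [abs_one] at hζ
      have hζ0 : ζ ≠ 0 := by
        rintro rfl; simp at hζ
      simp [hζ0]
    have hint : CircleIntegrable (fun ζ => (G ζ).re) 0 1 :=
      (continuous_re.comp_continuousOn hGc).circleIntegrable zero_le_one
    have e1 : circleAverage (fun ζ => ((G ζ).re : ℂ)) 0 1 =
        ofRealCLM (circleAverage (fun ζ => (G ζ).re) 0 1) := by
      rw [← ContinuousLinearMap.circleAverage_comp_comm ofRealCLM hint]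
      rfl
    have e2 : circleAverage (fun ζ => (G ζ).re) 0 1 = reCLM (circleAverage G 0 1) := by
      rw [← ContinuousLinearMap.circleAverage_comp_comm reCLM (hGc.circleIntegrable zero_le_one)]
      rfl
    rw [this, e1, e2, hmv]
    rfl
  calc Φ w = G w + (Φ 0 - G 0) := by linear_combination hcw - hc0
    _ = G w - I * (G 0).im := by
      rw [hΦ0]
      linear_combination Complex.re_add_im (G 0)

/-! ### The scaled Schwarz formula for a function holomorphic on the open disc -/

/-- `z ↦ G(rz)` is holomorphic on a neighbourhood of the closed unit disc when `0 ≤ r < 1`.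
[folklore] -/
theorem diffContOnCl_comp_mul {G : ℂ → ℂ} (hG : DifferentiableOn ℂ G (ball 0 1)) {r : ℝ}
    (hr : r ∈ Ico (0 : ℝ) 1) : DiffContOnCl ℂ (fun z => G (r * z)) (ball 0 1) := by
  apply DifferentiableOn.diffContOnCl
  rw [closure_ball 0 one_ne_zero]
  refine hG.comp (by fun_prop) ?_
  intro z hz
  simp only [mem_closedBall, dist_zero_right] at hz
  simp only [mem_ball, dist_zero_right, norm_mul, Complex.norm_real, Real.norm_eq_abs,
    abs_of_nonneg hr.1]
  calc r * ‖z‖ ≤ r * 1 := by gcongr; exact hr.1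
    _ < 1 := by simpa using hr.2

/-- `rζ` lies in the open unit disc for `ζ` on the unit circle and `0 ≤ r < 1`. [folklore] -/
theorem mul_mem_ball_of_mem_sphere {r : ℝ} (hr : r ∈ Ico (0 : ℝ) 1) {ζ : ℂ}
    (hζ : ζ ∈ sphere (0 : ℂ) 1) : (r : ℂ) * ζ ∈ ball (0 : ℂ) 1 := by
  simp only [mem_sphere_iff_norm, sub_zero] at hζ
  simp [hζ, abs_of_nonneg hr.1, hr.2]

/-- Scaled Schwarz formula: for `G` holomorphic on the open unit disc, `0 ≤ r < 1` and `|w| < 1`,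
`(2π)⁻¹ ∫₀^{2π} (e^{iθ} + w)/(e^{iθ} - w) Re G(re^{iθ}) dθ = G(rw) - i Im G(0)`. [folklore] -/
theorem circleAverage_herglotz_kernel_mul_re_scaled {G : ℂ → ℂ}
    (hG : DifferentiableOn ℂ G (ball 0 1)) {r : ℝ} (hr : r ∈ Ico (0 : ℝ) 1) {w : ℂ}
    (hw : w ∈ ball (0 : ℂ) 1) :
    circleAverage (fun ζ => (ζ + w) / (ζ - w) * ((G (r * ζ)).re : ℂ)) 0 1 =
      G (r * w) - I * (G 0).im := by
  simpa using circleAverage_herglotz_kernel_mul_re (diffContOnCl_comp_mul hG hr) hw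

/-- Continuity of the Herglotz kernel `ζ ↦ (ζ + w)/(ζ - w)` on the unit circle (`|w| < 1`).
[folklore] -/
theorem continuousOn_herglotz_kernel {w : ℂ} (hw : w ∈ ball (0 : ℂ) 1) :
    ContinuousOn (fun ζ : ℂ => (ζ + w) / (ζ - w)) (sphere (0 : ℂ) 1) := by
  refine ContinuousOn.div (by fun_prop) (by fun_prop) ?_
  intro z hz
  exact sub_ne_zero.2 (ne_of_mem_sphere_of_mem_ball hz hw)

/-- Continuity of `ζ ↦ Re G(rζ)` on the unit circle. [folklore] -/
theorem continuousOn_re_comp_mul {G : ℂ → ℂ} (hG : DifferentiableOn ℂ G (ball 0 1)) {r : ℝ}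
    (hr : r ∈ Ico (0 : ℝ) 1) : ContinuousOn (fun ζ : ℂ => (G (r * ζ)).re) (sphere (0 : ℂ) 1) := by
  refine continuous_re.comp_continuousOn (hG.continuousOn.comp (by fun_prop) ?_)
  intro ζ hζ
  exact mul_mem_ball_of_mem_sphere hr hζ

/-- Real part of the scaled Schwarz formula: the Poisson integral of `Re G(r·)` is `Re G(rw)`.
[folklore] -/
theorem circleAverage_re_kernel_mul_scaled {G : ℂ → ℂ} (hG : DifferentiableOn ℂ G (ball 0 1))
    {r : ℝ} (hr : r ∈ Ico (0 : ℝ) 1) {w : ℂ} (hw : w ∈ ball (0 : ℂ) 1) :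
    circleAverage (fun ζ => ((ζ + w) / (ζ - w)).re * (G (r * ζ)).re) 0 1 = (G (r * w)).re := by
  have h := circleAverage_herglotz_kernel_mul_re_scaled hG hr hw
  have hi : CircleIntegrable (fun ζ => (ζ + w) / (ζ - w) * ((G (r * ζ)).re : ℂ)) 0 1 :=
    ((continuousOn_herglotz_kernel hw).mul
      (continuous_ofReal.comp_continuousOn (continuousOn_re_comp_mul hG hr))).circleIntegrable
      zero_le_one
  have h2 := ContinuousLinearMap.circleAverage_comp_comm reCLM hi
  rw [h] at h2
  simp only [reCLM_apply, sub_re, mul_re, I_re, ofReal_re, zero_mul, I_im, ofReal_im, mul_zero,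
    sub_self, sub_zero] at h2
  rw [← h2]
  congr 1
  funext ζ
  simp [Complex.mul_re]

/-- Imaginary part of the scaled Schwarz formula: the conjugate-Poisson integral of `Re G(r·)` is
`Im G(rw) - Im G(0)`. [folklore] -/
theorem circleAverage_im_kernel_mul_scaled {G : ℂ → ℂ} (hG : DifferentiableOn ℂ G (ball 0 1))
    {r : ℝ} (hr : r ∈ Ico (0 : ℝ) 1) {w : ℂ} (hw : w ∈ ball (0 : ℂ) 1) :
    circleAverage (fun ζ => ((ζ + w) / (ζ - w)).im * (G (r * ζ)).re) 0 1 =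
      (G (r * w)).im - (G 0).im := by
  have h := circleAverage_herglotz_kernel_mul_re_scaled hG hr hw
  have hi : CircleIntegrable (fun ζ => (ζ + w) / (ζ - w) * ((G (r * ζ)).re : ℂ)) 0 1 :=
    ((continuousOn_herglotz_kernel hw).mul
      (continuous_ofReal.comp_continuousOn (continuousOn_re_comp_mul hG hr))).circleIntegrable
      zero_le_one
  have h2 := ContinuousLinearMap.circleAverage_comp_comm imCLM hi
  rw [h] at h2
  simp only [imCLM_apply, sub_im, mul_im, I_re, ofReal_im, mul_zero, I_im, ofReal_re, one_mul,
    zero_add] at h2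
  rw [← h2]
  congr 1
  funext ζ
  simp [Complex.mul_im]

/-- The mean value of `Re G(r·)` over the unit circle is `Re G(0)`. [folklore] -/
theorem circleAverage_re_comp_mul {G : ℂ → ℂ} (hG : DifferentiableOn ℂ G (ball 0 1)) {r : ℝ}
    (hr : r ∈ Ico (0 : ℝ) 1) : circleAverage (fun ζ : ℂ => (G (r * ζ)).re) 0 1 = (G 0).re := by
  have h1 : circleAverage (fun z => G (r * z)) 0 1 = G (r * 0) := by
    have h := diffContOnCl_comp_mul hG hr
    rw [← abs_one] at h
    exact h.circleAverage
  rw [mul_zero] at h1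
  have hi : CircleIntegrable (fun z => G (r * z)) 0 1 := by
    refine ContinuousOn.circleIntegrable zero_le_one (hG.continuousOn.comp (by fun_prop) ?_)
    intro ζ hζ
    exact mul_mem_ball_of_mem_sphere hr hζ
  have h2 := ContinuousLinearMap.circleAverage_comp_comm reCLM hi
  rw [h1] at h2
  exact h2

/-! ### Positive functionals on `C(𝕊, ℝ)` given by weights on the circle -/

/-- The standard parametrisation of the unit circle lands in the unit circle. [folklore] -/
theorem circleMap_zero_one_mem_sphere (θ : ℝ) : circleMap 0 1 θ ∈ sphere (0 : ℂ) 1 :=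
  circleMap_mem_sphere (0 : ℂ) zero_le_one θ

/-- A nonnegative continuous weight `P` on the unit circle defines the positive bounded linear
functional `φ ↦ (2π)⁻¹ ∫₀^{2π} φ(e^{iθ}) P(e^{iθ}) dθ` on `C(𝕊, ℝ)`, of norm at most the mean of
`P`. [folklore] -/
theorem exists_strongDual_circleAverage (P : ℂ → ℝ) (hP : ContinuousOn P (sphere (0 : ℂ) 1))
    (hP0 : ∀ ζ ∈ sphere (0 : ℂ) 1, 0 ≤ P ζ) :
    ∃ L : StrongDual ℝ C(sphere (0 : ℂ) 1, ℝ),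
      (∀ (φ : C(sphere (0 : ℂ) 1, ℝ)) (ψ : ℂ → ℝ), (∀ ζ : sphere (0 : ℂ) 1, φ ζ = ψ ζ) →
          L φ = circleAverage (fun ζ => ψ ζ * P ζ) 0 1) ∧
      (∀ φ : C(sphere (0 : ℂ) 1, ℝ), 0 ≤ φ → 0 ≤ L φ) ∧ ‖L‖ ≤ circleAverage P 0 1 := by
  set u : ℝ → sphere (0 : ℂ) 1 := fun θ => ⟨circleMap 0 1 θ, circleMap_zero_one_mem_sphere θ⟩
    with hu
  have hu_cont : Continuous u := (continuous_circleMap 0 1).subtype_mk _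
  have hPc : Continuous fun θ : ℝ => P (circleMap 0 1 θ) :=
    hP.comp_continuous (continuous_circleMap 0 1) circleMap_zero_one_mem_sphere
  have hint : ∀ φ : C(sphere (0 : ℂ) 1, ℝ),
      IntervalIntegrable (fun θ => φ (u θ) * P (circleMap 0 1 θ)) volume 0 (2 * π) := fun φ =>
    ((φ.continuous.comp hu_cont).mul hPc).intervalIntegrable _ _
  set Lₗ : C(sphere (0 : ℂ) 1, ℝ) →ₗ[ℝ] ℝ :=
    { toFun := fun φ => (2 * π)⁻¹ * ∫ θ in 0..2 * π, φ (u θ) * P (circleMap 0 1 θ)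
      map_add' := by
        intro φ₁ φ₂
        simp only [ContinuousMap.add_apply, add_mul]
        rw [intervalIntegral.integral_add (hint φ₁) (hint φ₂), mul_add]
      map_smul' := by
        intro a φ
        simp only [ContinuousMap.smul_apply, smul_eq_mul, RingHom.id_apply, mul_assoc]
        rw [intervalIntegral.integral_const_mul]
        ring } with hLₗ
  have hLₗ_apply : ∀ φ, Lₗ φ = (2 * π)⁻¹ * ∫ θ in 0..2 * π, φ (u θ) * P (circleMap 0 1 θ) :=
    fun φ => rfl
  have havg : circleAverage P 0 1 = (2 * π)⁻¹ * ∫ θ in 0..2 * π, P (circleMap 0 1 θ) := by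
    rw [Real.circleAverage_def, smul_eq_mul]
  have hbound : ∀ φ, ‖Lₗ φ‖ ≤ circleAverage P 0 1 * ‖φ‖ := by
    intro φ
    rw [hLₗ_apply, Real.norm_eq_abs, abs_mul, abs_of_pos (inv_pos.2 two_pi_pos), havg,
      mul_assoc, ← intervalIntegral.integral_mul_const]
    refine mul_le_mul_of_nonneg_left ?_ (inv_pos.2 two_pi_pos).le
    calc |∫ θ in 0..2 * π, φ (u θ) * P (circleMap 0 1 θ)|
        ≤ ∫ θ in 0..2 * π, |φ (u θ) * P (circleMap 0 1 θ)| :=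
          intervalIntegral.abs_integral_le_integral_abs two_pi_pos.le
      _ ≤ ∫ θ in 0..2 * π, P (circleMap 0 1 θ) * ‖φ‖ := by
          apply intervalIntegral.integral_mono_on two_pi_pos.le (hint φ).abs
            ((hPc.mul continuous_const).intervalIntegrable _ _)
          intro θ _
          rw [abs_mul, abs_of_nonneg (hP0 _ (circleMap_zero_one_mem_sphere θ)), mul_comm]
          exact mul_le_mul_of_nonneg_left (by simpa using φ.norm_coe_le_norm (u θ))
            (hP0 _ (circleMap_zero_one_mem_sphere θ))
  refine ⟨Lₗ.mkContinuous (circleAverage P 0 1) hbound, ?_, ?_, ?_⟩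
  · intro φ ψ hφψ
    rw [LinearMap.mkContinuous_apply, hLₗ_apply, Real.circleAverage_def, smul_eq_mul]
    congr 1
    apply intervalIntegral.integral_congr
    intro θ _
    simp only [hφψ, hu]
  · intro φ hφ
    rw [LinearMap.mkContinuous_apply, hLₗ_apply]
    refine mul_nonneg (inv_pos.2 two_pi_pos).le (intervalIntegral.integral_nonneg two_pi_pos.le ?_)
    intro θ _
    exact mul_nonneg (ContinuousMap.le_def.mp hφ (u θ)) (hP0 _ (circleMap_zero_one_mem_sphere θ))
  · apply LinearMap.mkContinuous_norm_le
    exact circleAverage_nonneg_of_nonneg (by simpa using hP0)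

/-! ### Cluster points in the weak-* topology -/

/-- A cluster point of a sequence is mapped by a continuous function to the limit of the image
sequence, when that limit exists. [folklore] -/
theorem apply_eq_of_mapClusterPt_of_tendsto {X : Type*} [TopologicalSpace X] {x : X} {u : ℕ → X}
    (h : MapClusterPt x atTop u) {g : X → ℝ} (hg : Continuous g) {a : ℝ}
    (hu : Tendsto (fun n => g (u n)) atTop (𝓝 a)) : g x = a := by
  have h1 : ClusterPt (g x) (map g (map u atTop)) := h.clusterPt.map hg.continuousAt tendsto_map
  rw [Filter.map_map] at h1
  exact t2_iff_nhds.mp inferInstance (h1.mono hu)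

/-- A cluster point of a sequence lying in a closed set lies in that set. [folklore] -/
theorem mem_of_mapClusterPt_of_forall_mem {X : Type*} [TopologicalSpace X] {x : X} {u : ℕ → X}
    (h : MapClusterPt x atTop u) {s : Set X} (hs : IsClosed s) (hu : ∀ n, u n ∈ s) : x ∈ s :=
  isClosed_iff_clusterPt.mp hs x
    (h.clusterPt.mono (le_principal_iff.2 (mem_map.2 (Eventually.of_forall hu))))

/-! ### The Herglotz–Riesz representation theorem on the unit disc -/

/-- Continuity on the unit circle (as a subtype) of the real and imaginary parts of the Herglotz
kernel. [folklore] -/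
theorem continuous_restrict_herglotz_kernel {w : ℂ} (hw : w ∈ ball (0 : ℂ) 1) :
    Continuous fun ζ : sphere (0 : ℂ) 1 => ((ζ : ℂ) + w) / ((ζ : ℂ) - w) :=
  (continuousOn_herglotz_kernel hw).comp_continuous continuous_subtype_val fun ζ => ζ.2

/-- **Herglotz–Riesz representation theorem.** A holomorphic function `G` on the open unit disc
with `Re G ≥ 0` is `G(w) = i Im G(0) + ∫ (ζ + w)/(ζ - w) dν(ζ)` for a finite positive Borel
measure `ν` on the unit circle. Proof: the functionals `φ ↦ (2π)⁻¹∫ φ(e^{iθ}) Re G(rₙe^{iθ}) dθ`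
(`rₙ ↑ 1`) have norm `Re G(0)` (mean value property); a weak-* cluster point (Banach–Alaoglu) is a
positive functional, represented by a measure `ν` (Riesz–Markov–Kakutani), and its values on the
kernel functions are computed by the scaled Schwarz formula. (G. Herglotz, Leipz. Ber. 63 (1911)
501–511; F. Riesz, 1911.) [folklore] -/
theorem exists_measure_herglotz_riesz {G : ℂ → ℂ} (hG : DifferentiableOn ℂ G (ball 0 1))
    (hG0 : ∀ w ∈ ball (0 : ℂ) 1, 0 ≤ (G w).re) :
    ∃ ν : Measure (sphere (0 : ℂ) 1), IsFiniteMeasure ν ∧ ∀ w ∈ ball (0 : ℂ) 1,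
      G w = I * (G 0).im + ∫ ζ, ((ζ : ℂ) + w) / ((ζ : ℂ) - w) ∂ν := by
  -- radii `rₙ = 1 - 1/(n+2) ↑ 1`
  set r : ℕ → ℝ := fun n => 1 - 1 / ((n : ℝ) + 2) with hr
  have hr_mem : ∀ n, r n ∈ Ico (0 : ℝ) 1 := by
    intro n
    have h2 : (0 : ℝ) < (n : ℝ) + 2 := by positivity
    constructor
    · simp only [hr, sub_nonneg]
      rw [div_le_one h2]
      linarith
    · simp only [hr, sub_lt_self_iff]
      positivity
  have hr_lim : Tendsto r atTop (𝓝 1) := by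
    have h : Tendsto (fun n : ℕ => 1 / ((n : ℝ) + 2)) atTop (𝓝 0) :=
      tendsto_const_nhds.div_atTop
        (tendsto_atTop_add_const_right _ 2 tendsto_natCast_atTop_atTop)
    simpa [hr] using (tendsto_const_nhds (x := (1 : ℝ))).sub h
  -- the functionals
  choose L hLψ hLpos hLnorm using fun n =>
    exists_strongDual_circleAverage _ (continuousOn_re_comp_mul hG (hr_mem n))
      (fun ζ hζ => hG0 _ (mul_mem_ball_of_mem_sphere (hr_mem n) hζ))
  have hLnorm' : ∀ n, ‖L n‖ ≤ (G 0).re := fun n =>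
    (hLnorm n).trans (circleAverage_re_comp_mul hG (hr_mem n)).le
  -- Banach–Alaoglu: a weak-* cluster point
  set K : Set (WeakDual ℝ C(sphere (0 : ℂ) 1, ℝ)) :=
    WeakDual.toStrongDual ⁻¹' closedBall 0 ((G 0).re) with hK_def
  have hK : IsCompact K := WeakDual.isCompact_closedBall 0 _
  set x : ℕ → WeakDual ℝ C(sphere (0 : ℂ) 1, ℝ) := fun n => StrongDual.toWeakDual (L n) with hx
  have hxK : ∀ n, x n ∈ K := by
    intro n
    exact (mem_closedBall_zero_iff (E := StrongDual ℝ C(sphere (0 : ℂ) 1, ℝ))).mpr (hLnorm' n)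
  obtain ⟨Λ, -, hΛ⟩ := hK.exists_mapClusterPt (f := atTop) (u := x)
    (le_principal_iff.2 (mem_map.2 (Eventually.of_forall hxK)))
  have hx_apply : ∀ n φ, x n φ = L n φ := fun n φ => rfl
  -- transfer of limits and of positivity to the cluster point
  have hev : ∀ (φ : C(sphere (0 : ℂ) 1, ℝ)) (a : ℝ),
      Tendsto (fun n => L n φ) atTop (𝓝 a) → Λ φ = a := fun φ a hφ =>
    apply_eq_of_mapClusterPt_of_tendsto hΛ (WeakDual.eval_continuous φ) hφ
  have hpos : ∀ φ : C(sphere (0 : ℂ) 1, ℝ), 0 ≤ φ → 0 ≤ Λ φ := fun φ hφ =>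
    mem_of_mapClusterPt_of_forall_mem hΛ (s := {y | 0 ≤ y φ})
      (isClosed_le continuous_const (WeakDual.eval_continuous φ)) fun n => hLpos n φ hφ
  -- the Riesz–Markov–Kakutani measure of `Λ`
  set Λₗ : C_c(sphere (0 : ℂ) 1, ℝ) →ₗ[ℝ] ℝ :=
    { toFun := fun f => Λ f.toContinuousMap
      map_add' := by
        intro f g
        have : (f + g).toContinuousMap = f.toContinuousMap + g.toContinuousMap := by
          ext; rfl
        rw [this, map_add]
      map_smul' := by
        intro a f
        have : (a • f).toContinuousMap = a • f.toContinuousMap := by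
          ext; rfl
        rw [this, map_smul]
        rfl } with hΛₗ
  have hΛₗ_apply : ∀ f, Λₗ f = Λ f.toContinuousMap := fun f => rfl
  set Λp : C_c(sphere (0 : ℂ) 1, ℝ) →ₚ[ℝ] ℝ := PositiveLinearMap.mk₀ Λₗ (by
    intro f hf
    rw [hΛₗ_apply]
    apply hpos
    intro ζ
    exact hf ζ) with hΛp
  have hΛp_apply : ∀ f, Λp f = Λ f.toContinuousMap := fun f => rfl
  set ν : Measure (sphere (0 : ℂ) 1) := RealRMK.rieszMeasure Λp with hν
  have hνint : ∀ φ : C(sphere (0 : ℂ) 1, ℝ), ∫ ζ, φ ζ ∂ν = Λ φ := by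
    intro φ
    have h := RealRMK.integral_rieszMeasure Λp ⟨φ, HasCompactSupport.of_compactSpace φ⟩
    rw [hΛp_apply] at h
    exact h
  refine ⟨ν, inferInstance, fun w hw => ?_⟩
  -- the kernel functions and the value of `Λ` on them
  set φre : C(sphere (0 : ℂ) 1, ℝ) :=
    ⟨fun ζ => (((ζ : ℂ) + w) / ((ζ : ℂ) - w)).re,
      continuous_re.comp (continuous_restrict_herglotz_kernel hw)⟩ with hφre
  set φim : C(sphere (0 : ℂ) 1, ℝ) :=
    ⟨fun ζ => (((ζ : ℂ) + w) / ((ζ : ℂ) - w)).im,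
      continuous_im.comp (continuous_restrict_herglotz_kernel hw)⟩ with hφim
  have hGw : Tendsto (fun n => G (r n * w)) atTop (𝓝 (G w)) := by
    have h1 : Tendsto (fun n => (r n : ℂ) * w) atTop (𝓝 w) := by
      have := ((continuous_ofReal.tendsto 1).comp hr_lim).mul_const w
      simpa using this
    exact ((hG.continuousOn w hw).tendsto.comp
      (tendsto_nhdsWithin_of_tendsto_nhds_of_eventually_within _ h1
        (Eventually.of_forall fun n => by
          simpa [abs_of_nonneg (hr_mem n).1] using
            mul_lt_one_of_nonneg_of_lt_one_left (hr_mem n).1 (hr_mem n).2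
              (le_of_lt (by simpa using hw)))))
  have hΛre : Λ φre = (G w).re := by
    apply hev
    have : ∀ n, L n φre = (G (r n * w)).re := fun n => by
      rw [hLψ n φre (fun ζ : ℂ => ((ζ + w) / (ζ - w)).re) (fun ζ => rfl)]
      exact circleAverage_re_kernel_mul_scaled hG (hr_mem n) hw
    simp_rw [this]
    exact (continuous_re.tendsto _).comp hGw
  have hΛim : Λ φim = (G w).im - (G 0).im := by
    apply hev
    have : ∀ n, L n φim = (G (r n * w)).im - (G 0).im := fun n => by
      rw [hLψ n φim (fun ζ : ℂ => ((ζ + w) / (ζ - w)).im) (fun ζ => rfl)]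
      exact circleAverage_im_kernel_mul_scaled hG (hr_mem n) hw
    simp_rw [this]
    exact ((continuous_im.tendsto _).comp hGw).sub_const _
  -- the integral of the kernel
  have hint_re : Integrable (fun ζ : sphere (0 : ℂ) 1 => (φre ζ : ℂ)) ν :=
    (continuous_ofReal.comp φre.continuous).integrable_of_hasCompactSupport
      (HasCompactSupport.of_compactSpace _)
  have hint_im : Integrable (fun ζ : sphere (0 : ℂ) 1 => (φim ζ : ℂ) * I) ν :=
    ((continuous_ofReal.comp φim.continuous).mul continuous_const).integrable_of_hasCompactSupport
      (HasCompactSupport.of_compactSpace _)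
  have hsplit : ∫ ζ, ((ζ : ℂ) + w) / ((ζ : ℂ) - w) ∂ν =
      ((∫ ζ, φre ζ ∂ν : ℝ) : ℂ) + ((∫ ζ, φim ζ ∂ν : ℝ) : ℂ) * I := by
    have h1 : (fun ζ : sphere (0 : ℂ) 1 => ((ζ : ℂ) + w) / ((ζ : ℂ) - w)) =
        fun ζ => (φre ζ : ℂ) + (φim ζ : ℂ) * I := by
      funext ζ
      exact (re_add_im _).symm
    rw [h1, integral_add hint_re hint_im, integral_mul_const, integral_complex_ofReal,
      integral_complex_ofReal]
  rw [hsplit, hνint, hνint, hΛre, hΛim]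
  apply Complex.ext <;> simp

end Literature.Analysis.Complex
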